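import Literature.MathematicalPhysics.QuantumFieldTheory.Balaban1983to89.B1Ineq233LowerZeroFieldTorus
import Literature.MathematicalPhysics.QuantumFieldTheory.Balaban1983to89.B2Eq28RegionsConcrete

/-!
# `Balaban1983to89.B1Ineq233LowerZeroFieldRegion` — T. Bałaban, *(Higgs)₂,₃ quantum fields in a finite volume. I. A lower bound*,
# Commun. Math. Phys. **85** (1982) 603–626 [Balaban1982Higgs1], Proposition 2.3 p. 611: the LOWER HALF of (2.33)
# `γ₀I ≦ aL^{−2}P(A) + Δ^{(k)}(Ω, A)` AT ZERO FIELD FOR THE PRINTED REGIONS `Ω = B^k(Ω^{(k)})`, `Ω^{(k)} ⊂ T^{(k)}` A UNION OF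
# (BIG) BLOCKS, for the CONCRETE (Higgs)₂,₃ operators (`B1Eq230FluctCov.precOpA`) read, as printed, *"on configurations
# φ : Ω^{(k)} → R^N"* — i.e. for every field SUPPORTED IN `Ω^{(k)}` —, with ONE explicit `γ₀(d, a, L, m²)` for all `1 ≤ k < K`, all
# regions, all volumes and all `ε` with `L^kε ≤ 1`, and at `k = 0` for every `ε`; removes the restriction `Ω = T_ε` of
# `B1Ineq233LowerZeroFieldTorus` (r14 g7) for the lower half

statement-level skeleton of published theorems with citation tags; proofs where landed; nothing here is a claim about the Yang–Mills mass gap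

PDFs held: `paper:balaban1982-cmp85-higgs23-i` (journal page = PDF page + 602), pp. 610–611 [PDF 8–9] READ AS IMAGES on the ×2
renders `run/shared/lean/pub/pub-balaban/b2b-balaban-ref1/pages/1982-cmp85-higgs23-I/1982-cmp85-higgs23-I-p008-x2.png`, `-p009-x2.png`;
`paper:balaban1982-cmp86-higgs23-ii` (journal page = PDF page + 554), pp. 589–590 [PDF 35–36] (`…-II-p035/p036-x2.png`);
`paper:balaban1983-cmp89-regularity-decay` p. 580 [PDF 10] ((2.27), the block Poincaré inequality).

CITATION HEADER (lean-in-tree rule).  Cell `lit-balaban` (HOME `run/shared/lean/pub/lit-balaban/`), seat **r14** gen 8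
(reader/typer of B1/B2, fold owner of SKELETON row **B1.Prop2.3**; unit `lit-balaban-r14-g8`).  WHAT IS REPRODUCED: row
B1.Prop2.3, member (2.33) LOWER HALF, kind «model instance at zero field on the concrete carrier, printed regions»: the decls
of record `B1.Prop23Literal` / `B1.Prop23Intended` (pv07) are UNTOUCHED; this file only COMPOSES, by name, r14 g7's
`B1Ineq233LowerZeroField` (block Poincaré `block_poincare_vec`, `sum_ite_inside_block_le`, `siteInner_blockProjA_zero`), p15 g4's
`B2Prop31ZeroFieldConcrete.ineq329_zero_deltaKA` ((II.3.29)₀ for the concrete `Δ^{(k)}(B^k(Λ_k), 0)` on p15's `Regions`, with its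
`bondK`/`massK`/`extL`), the typer's `HiggsRescaling.IsUnionOfLargeBlocks` / `B2Eq28RegionsConcrete.isUnionOfLargeBlocks_blockOf_congr`
(big blocks are unions of blocks) and `HiggsLattice.blockSet` ((1.18) `B(Λ)`).  Nothing is redefined; no definition at all in this file.

WHAT IS PRINTED.  B1 p. 611 [PDF 9]: *"For an operator A defined on configurations φ : Ω^{(k)} → R^N we define A↾_Λ as an
operator on configurations φ : Λ → R^N by the formula A↾_Λφ = ΛAΛφ. … Proposition 2.3. If a configuration A is regular on Ω in the
sense defined in Proposition 2.1, then there exist positive constants δ₀, c₀, γ₀, γ₁, dependent on d and a, and independent of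
A, k, Ω and Λ, such that γ₀I ≦ aL^{−2}P(A) + Δ^{(k)}(Ω, A) ≦ γ₁I, (2.33)"*; p. 610 [PDF 8]: *"Proposition 2.1. Let a set Ω satisfies
Ω = B^k(Ω^{(k)}) and let Ω^{(k)} ⊂ T₁^{(k)} be a sum of big blocks with M sufficiently large."*, *"In this paper we will use the case
Ω = T_ε only, but in the second part the necessity of the considerations of more general Ω will arise."*; p. 607 [PDF 5]: big
blocks = *"the same way, only L is replaced by ML"*.  II p. 590 (3.29) at `Ã = 0` (p. 589: *"If Ã^ε = 0, then the inequality
holds without the last sum on the right side and without any restrictions on the configuration Φ"*):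
`⟨φ′_k, Δ^{(k)}(B^k(Λ_k), 0)φ′_k⟩ ≧ γ₀(Σ_{⟨x,x′⟩⊂Λ_k}(L^kε)^{d−2}|φ′_k(x′) − φ′_k(x)|² + Σ_{x∈Λ_k}m²(L^kε)²|φ′_k(x)|²)` *"with a constant
γ₀ independent of k, Λ_k"*.  [Balaban1983RegularityDecay] (2.27) p. 580: the Poincaré inequality on a block.

DICTIONARY (print ↦ Lean).  `Ω^{(k)}` ↦ a finite set `S` of sites of `T^{(k)}` (`R.block j` of p15's `Regions`, `k = j + 1`),
`Ω = B^k(Ω^{(k)})` ↦ p15's `pieceF R j` (`= {x ∈ T_ε : x_k ∈ Λ_k}`, `B2Prop31ZeroFieldConcrete.mem_pieceF_iff`); *"a sum of big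
blocks"* ↦ the typer's `HiggsRescaling.IsUnionOfLargeBlocks S`, used only through its consequence *"a sum of blocks"*
`∀ x x′, blockOf x = blockOf x′ → (x ∈ S ↔ x′ ∈ S)` (the hypothesis `hS` below; `blockSet Λ′` and every union of big blocks
satisfy it: `blockOf_congr_blockSet`, `blockOf_congr_of_isUnionOfLargeBlocks`); *"configurations φ : Ω^{(k)} → R^N"* ↦ fields
`ψ : LSite R j → ℝ^N` on `Λ_k`, extended by zero `extL R j ψ` (p15), resp. fields `ψ` on `T^{(k)}` vanishing off `S`; the operator
`a(L^{k+1}ε)^{−2}P(0) + Δ^{(k),L^kε}(Ω, 0)` ↦ p35's `precOpA C (pieceF R j) 0 m² a k` (the `L^kε`-lattice form of (2.30); on the unit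
lattice `L^kη = 1` it is the printed `aL^{−2}P(0) + Δ^{(k)}(Ω,0)`, cf. `B1Ineq233LowerZeroFieldTorus.ineq233_lower_zeroField_unitAt`).

WHAT THIS FILE PROVES (kernel-checked, zero `sorry`, standard axioms; theorems only):
* §1 **the block Poincaré inequality keeping only the bonds inside a union of blocks**: `sum_blocks_inside_le_inside` (for `S` a
  union of blocks and `ψ` vanishing off `S`, the in-block bond sum of `ψ` over ALL blocks of `T^{(k)}` is bounded by the sum over
  the bonds INSIDE `S`) and **`siteInner_self_le_blockProjA_add_inside`**: `‖ψ‖² ≤ ⟨ψ, P(0)ψ⟩ + (L²/8)(L^kε)²·Σ_{b⊂S}(L^kε)^d|∂ψ(b)|²`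
  (`k < K`) — the support-respecting form of r14 g7's `siteInner_self_le_blockProjA_add` (whose last term runs over all bonds of
  `T^{(k)}`, including the boundary bonds of `S` that (3.29) does not control); `lower_arith` (the common arithmetic).
* §2 **`ineq233_lower_zeroField_region`** (`1 ≤ k = j + 1 < K`, `L^kε ≤ 1`, `m² > 0`, `a > 0`, `L > 1`): for every region data `R`
  with `Λ_k = R.block j` a union of blocks and EVERY `ψ : Λ_k → ℝ^N`,
  `(min{a, 8γ₀}/L²)(L^kε)^{−2}‖ψ̃‖² ≤ ⟨ψ̃, (a(L^{k+1}ε)^{−2}P(0) + Δ^{(k),L^kε}(B^k(Λ_k), 0))ψ̃⟩`, `ψ̃ = extL R j ψ`, with p15's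
  `γ₀ = gamma0 P a m² = min(a(1 − L⁻²)/(8d + 2m²), 1/4)` — ONE constant for all `k`, all regions, all volumes; the big-block
  reading `ineq233_lower_zeroField_region_largeBlocks` (`IsUnionOfLargeBlocks (R.block j)`); the scale-free form `_uniform`;
  **`ineq233_zeroField_region_twoSided`**: BOTH HALVES of (2.33) at zero field for these regions and fields, the upper half
  `≤ (aL^{−2} + a)(L^kε)^{−2}‖ψ̃‖²` being r14 g6's `B1Ineq233Upper.siteInner_precOpA_succ_le_uniform` (every `A`, `Ω`, field).
* §3 **`ineq233_lower_zeroField_region_levelZero`** (`k = 0`, every `ε`, `a, m² ≥ 0`, `0 < K`): for every `Ω ⊂ T_ε` that is a union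
  of blocks and every `ψ` vanishing off `Ω`, `(min{a, 8}/L²)ε^{−2}‖ψ‖² ≤ ⟨ψ, (a(Lε)^{−2}P(0) + Δ^{(0),ε}(Ω, 0))ψ⟩` — from (2.17)
  `⟨ψ, Δ^{(0),ε}(Ω,0)ψ⟩ = Σ_{b⊂Ω}ε^d|∂ψ(b)|² + m²‖ψ‖²` (`siteInner_deltaKA_zero_region`), no smallness hypothesis; `_blockSet` and
  `_largeBlocks` readings.
HONEST SCOPE.  (i) Zero external field only (general regular `A` = [B4] Prop. II.3.1′, not here); the UPPER half for every `A`
and every `Ω` is r14 g6's `B1Ineq233Upper`.  (ii) The bound is for fields SUPPORTED IN `Ω^{(k)}` — the printed reading; for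
fields on all of `T^{(k)}` and `Ω ≠ T_ε` no uniform bound holds for the typer's operators (outside `Ω` only the mass term acts),
and none is claimed.  (iii) `γ₀ ↦ min{a, 8γ₀(p15)}/L²` depends on `d, a, L, m²` (the print: "on d and a"; census G-B4-03 for the
Poincaré constant `8` vs `π²`).  (iv) `L^kε ≤ 1` (`k ≥ 1`) is (3.29)'s standing hypothesis at scale `k`; automatic on the unit
lattice.  (v) "a sum of big blocks" enters only as "a sum of blocks" (weaker hypothesis, so the printed case is covered); `M`
plays no role at zero field.  (vi) Value = kernel certificate that the printed lower bound holds, at zero field, for the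
printed class of regions and the printed class of configurations; NOT summit progress.  Unit `lit-balaban-r14-g8`
(literature-prover-lit-balaban-r14-g8-0); HOME/FILED.md records the proposal.
-/

open scoped BigOperators InnerProductSpace

namespace Literature.MathematicalPhysics.QuantumFieldTheory.Balaban1983to89.B1Ineq233LowerZeroFieldRegion

open HiggsLattice HiggsAveraging HiggsCovariance HiggsCovariancePos B1Eq230FluctCov B1Eq230FluctCovPos HiggsCondCov232
open HiggsFluctMeasure (coeff221)
open HiggsFluctMeasurePos (siteInner_add_right siteInner_smul_right)
open HiggsRescaling (IsUnionOfLargeBlocks)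
open B2Eq337ScalarIntegration (Regions V)
open B2Eq328ConcretePieces (LSite pieceF inPiece mem_pieceF)
open B2Eq328DeltaK (extL)
open B2Prop31ZeroFieldConcrete (bondK massK gamma0 gamma0_pos ineq329_zero_deltaKA massK_nonneg bondK_nonneg
  extL_apply_of_not)
open B1Ineq233LowerZeroField (siteInner_blockProjA_zero block_poincare_vec sum_ite_inside_block_le mesh_succ)
open B2Eq28RegionsConcrete (isUnionOfLargeBlocks_blockOf_congr)

variable {P : HiggsLattice.Params} {N K : ℕ}

/-! ## §1 The block Poincaré inequality keeping only the bonds inside a union of blocks -/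

section Poincare

variable {k : ℕ}

/-- `B(Λ′)` is a union of blocks: membership in `blockSet Λ′` depends on the block only ((1.18) p. 607).
[cite: Balaban1982Higgs1, (1.18) p.607] -/
theorem blockOf_congr_blockSet (Λ' : Finset (HiggsLattice.Site P (k + 1))) (x x' : HiggsLattice.Site P k)
    (h : HiggsLattice.blockOf x = HiggsLattice.blockOf x') : x ∈ HiggsLattice.blockSet Λ' ↔ x' ∈ HiggsLattice.blockSet Λ' := by
  rw [HiggsLattice.mem_blockSet, HiggsLattice.mem_blockSet, h]

/-- *"a sum of big blocks"* (p. 610) is a sum of blocks: membership in a union of big blocks of `T^{(k)}` depends on the block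
only (the typer's `isUnionOfLargeBlocks_blockOf_congr`: a big block, side `LM`, is a union of blocks of side `L`).
[cite: Balaban1982Higgs1, p.607; Prop. 2.1 p.610] -/
theorem blockOf_congr_of_isUnionOfLargeBlocks {S : Finset (HiggsLattice.Site P k)} (hS : IsUnionOfLargeBlocks S)
    (x x' : HiggsLattice.Site P k) (h : HiggsLattice.blockOf x = HiggsLattice.blockOf x') : x ∈ S ↔ x' ∈ S :=
  isUnionOfLargeBlocks_blockOf_congr hS h

/-- For `S ⊂ T^{(k)}` a union of blocks and `ψ` vanishing off `S`: the in-block bond sums of `ψ`, summed over ALL blocks of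
`T^{(k)}`, are bounded by the sum over the bonds INSIDE `S` (a bond inside a block has both ends in `S` or both ends off `S`,
where `ψ = 0`). [cite: Balaban1982Higgs1, (1.17)–(1.18) p.606–607] -/
theorem sum_blocks_inside_le_inside (S : Finset (HiggsLattice.Site P k))
    (hS : ∀ x x' : HiggsLattice.Site P k, HiggsLattice.blockOf x = HiggsLattice.blockOf x' → (x ∈ S ↔ x' ∈ S))
    (ψ : ScalarField P k N) (hψ : ∀ x, x ∉ S → ψ x = 0) :
    ∑ y : HiggsLattice.Site P (k + 1), ∑ b : HiggsLattice.PBond P k,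
        (if Inside (HiggsLattice.block y) b then ‖ψ b.tgt - ψ b.src‖ ^ 2 else 0)
      ≤ ∑ b : HiggsLattice.PBond P k, (if Inside S b then ‖ψ b.tgt - ψ b.src‖ ^ 2 else 0) := by
  classical
  rw [Finset.sum_comm]
  refine Finset.sum_le_sum fun b _ => ?_
  by_cases hb : Inside S b
  · rw [if_pos hb]
    exact sum_ite_inside_block_le b (sq_nonneg _)
  · rw [if_neg hb]
    refine Finset.sum_nonpos fun y _ => ?_
    by_cases hy : Inside (HiggsLattice.block y) b
    · rw [if_pos hy]
      have hsrc : HiggsLattice.blockOf b.src = y := by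
        have := hy.1
        simp only [HiggsLattice.block, Finset.mem_filter, Finset.mem_univ, true_and] at this
        exact this
      have htgt : HiggsLattice.blockOf b.tgt = y := by
        have := hy.2
        simp only [HiggsLattice.block, Finset.mem_filter, Finset.mem_univ, true_and] at this
        exact this
      have hiff : b.src ∈ S ↔ b.tgt ∈ S := hS b.src b.tgt (by rw [hsrc, htgt])
      have hs : b.src ∉ S := fun h => hb ⟨h, hiff.mp h⟩
      have ht : b.tgt ∉ S := fun h => hs (hiff.mpr h)
      rw [hψ _ hs, hψ _ ht, sub_zero, norm_zero]
      norm_num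
    · rw [if_neg hy]

/-- **`‖ψ‖² ≤ ⟨ψ, P(0)ψ⟩ + (L²/8)(L^kε)²·Σ_{b⊂S}(L^kε)^d|(∂ψ)(b)|²`** for `S` a union of blocks of `T^{(k)}` (`k < K`) and every field
`ψ` vanishing off `S` — the block Poincaré inequality ([B4] (2.27)) summed over the blocks, with ONLY THE BONDS INSIDE `S` on the
right (the bonds controlled by (II.3.29)). [cite: Balaban1983RegularityDecay, (2.27) p.580] -/
theorem siteInner_self_le_blockProjA_add_inside (C : ChargeData N) (hk : k < P.K) (S : Finset (HiggsLattice.Site P k))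
    (hS : ∀ x x' : HiggsLattice.Site P k, HiggsLattice.blockOf x = HiggsLattice.blockOf x' → (x ∈ S ↔ x' ∈ S))
    (ψ : ScalarField P k N) (hψ : ∀ x, x ∉ S → ψ x = 0) :
    siteInner ψ ψ ≤ siteInner ψ (blockProjA C (0 : HiggsLattice.VecField P 0) k ψ)
      + (P.L : ℝ) ^ 2 / 8 * P.mesh k ^ 2 *
        ∑ b : HiggsLattice.PBond P k, (if Inside S b then P.mesh k ^ P.d * ‖sderiv ψ b‖ ^ 2 else 0) := by
  classical
  have hm : 0 < P.mesh k := P.mesh_pos k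
  have hmd : 0 < P.mesh k ^ P.d := pow_pos hm _
  -- the three sums, block by block
  have h1 : siteInner ψ ψ = P.mesh k ^ P.d * ∑ y : HiggsLattice.Site P (k + 1), ∑ x ∈ HiggsLattice.block y, ‖ψ x‖ ^ 2 := by
    rw [siteInner, ← Finset.mul_sum]
    congr 1
    simp_rw [real_inner_self_eq_norm_sq]
    exact (Finset.sum_fiberwise_of_maps_to (s := Finset.univ) (t := Finset.univ)
      (g := fun x : HiggsLattice.Site P k => HiggsLattice.blockOf x) (fun _ _ => Finset.mem_univ _) _).symm
  have h2 := siteInner_blockProjA_zero C (k := k) ψ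
  have h3 : P.mesh k ^ 2 * ∑ b : HiggsLattice.PBond P k, (if Inside S b then P.mesh k ^ P.d * ‖sderiv ψ b‖ ^ 2 else 0)
      = P.mesh k ^ P.d * ∑ b : HiggsLattice.PBond P k, (if Inside S b then ‖ψ b.tgt - ψ b.src‖ ^ 2 else 0) := by
    rw [Finset.mul_sum, Finset.mul_sum]
    refine Finset.sum_congr rfl fun b _ => ?_
    split_ifs
    · rw [HiggsLattice.sderiv, norm_smul, mul_pow, Real.norm_eq_abs, abs_inv, abs_of_pos hm]
      field_simp
    · simp
  have h4 := sum_blocks_inside_le_inside S hS ψ hψ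
  have hblocks := Finset.sum_le_sum fun y (_ : y ∈ (Finset.univ : Finset (HiggsLattice.Site P (k + 1)))) =>
    block_poincare_vec hk y ψ
  rw [Finset.sum_sub_distrib, ← Finset.mul_sum, ← Finset.mul_sum] at hblocks
  rw [h1, h2, mul_assoc ((P.L : ℝ) ^ 2 / 8), h3]
  have hL8 : 0 ≤ (P.L : ℝ) ^ 2 / 8 := by positivity
  nlinarith [mul_le_mul_of_nonneg_left h4 hL8, hblocks, hmd]

/-- The arithmetic of the lower bound: from `‖ψ‖² ≤ X + (L²/8)m²S` (Poincaré), `γ₀S ≤ D` ((3.29)-type bound) and `X, S ≥ 0`: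
`(min{a, 8γ₀}/L²)m⁻²‖ψ‖² ≤ a(Lm)⁻²X + D`. [cite: Balaban1982Higgs1, Prop. 2.3 (2.33) p.611] -/
theorem lower_arith {L m a γ₀ X S D nrm : ℝ} (hL : 1 ≤ L) (hm : 0 < m) (ha : 0 ≤ a) (hγ : 0 ≤ γ₀)
    (hX : 0 ≤ X) (hS : 0 ≤ S) (hψ : nrm ≤ X + L ^ 2 / 8 * m ^ 2 * S) (hΔ : γ₀ * S ≤ D) :
    min a (8 * γ₀) / L ^ 2 * (m⁻¹ ^ 2) * nrm ≤ a * ((L * m)⁻¹ ^ 2) * X + D := by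
  have hL0 : (0 : ℝ) < L := by linarith
  have hmin1 : min a (8 * γ₀) ≤ a := min_le_left _ _
  have hmin2 : min a (8 * γ₀) ≤ 8 * γ₀ := min_le_right _ _
  have hmin0 : 0 ≤ min a (8 * γ₀) := le_min ha (by linarith)
  have hinv : (L * m)⁻¹ ^ 2 = (L ^ 2)⁻¹ * m⁻¹ ^ 2 := by
    rw [mul_inv, mul_pow, inv_pow]
  rw [hinv]
  have hm2 : 0 < m⁻¹ ^ 2 := by positivity
  have hc0 : (0 : ℝ) ≤ min a (8 * γ₀) / L ^ 2 * m⁻¹ ^ 2 :=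
    mul_nonneg (div_nonneg hmin0 (pow_nonneg hL0.le 2)) hm2.le
  have h1 : min a (8 * γ₀) / L ^ 2 * m⁻¹ ^ 2 * nrm
      ≤ min a (8 * γ₀) / L ^ 2 * m⁻¹ ^ 2 * (X + L ^ 2 / 8 * m ^ 2 * S) :=
    mul_le_mul_of_nonneg_left hψ hc0
  have h2 : min a (8 * γ₀) / L ^ 2 * m⁻¹ ^ 2 * (X + L ^ 2 / 8 * m ^ 2 * S)
      = min a (8 * γ₀) / L ^ 2 * m⁻¹ ^ 2 * X + min a (8 * γ₀) / 8 * S := by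
    field_simp
  have h3 : min a (8 * γ₀) / L ^ 2 * m⁻¹ ^ 2 * X ≤ a * ((L ^ 2)⁻¹ * m⁻¹ ^ 2) * X := by
    have : min a (8 * γ₀) / L ^ 2 * m⁻¹ ^ 2 ≤ a * ((L ^ 2)⁻¹ * m⁻¹ ^ 2) := by
      rw [div_eq_mul_inv, mul_assoc]
      exact mul_le_mul_of_nonneg_right hmin1 (by positivity)
    exact mul_le_mul_of_nonneg_right this hX
  have h4 : min a (8 * γ₀) / 8 * S ≤ γ₀ * S := mul_le_mul_of_nonneg_right (by linarith) hS
  linarith [h1, h2, h3, h4, hΔ]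

end Poincare

/-! ## §2 (2.33), lower half, at zero field, for `Ω = B^k(Ω^{(k)})` with `Ω^{(k)}` a union of (big) blocks, `1 ≤ k < K` -/

section Region

variable (R : Regions P K) (C : ChargeData N) {a msq : ℝ}

/-- The in-`Λ_k` bond sum of §1 for the zero extension `ψ̃` IS p15's (3.26)/(3.29) bond sum `bondK` (definitionally).
[cite: Balaban1982Higgs2, Prop. 3.1 (3.26) p.589] -/
theorem sum_inside_eq_bondK (j : Fin K) (ψ : LSite R j → V N) :
    (∑ b : HiggsLattice.PBond P (j.val + 1), (if Inside (R.block j) b then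
      P.mesh (j.val + 1) ^ P.d * ‖sderiv (extL R j ψ) b‖ ^ 2 else 0)) = bondK R j ψ := rfl

/-- **(2.33), LOWER HALF, AT ZERO FIELD, FOR THE PRINTED REGIONS** (`Ω = B^k(Λ_k)`, `Λ_k = Ω^{(k)} ⊂ T^{(k)}` a union of blocks,
`1 ≤ k = j + 1 < K`, `L^kε ≤ 1`): for EVERY `ψ : Λ_k → ℝ^N`,
`(min{a, 8γ₀}/L²)·(L^kε)^{−2}·‖ψ̃‖² ≤ ⟨ψ̃, (a(L^{k+1}ε)^{−2}P(0) + Δ^{(k),L^kε}(B^k(Λ_k), 0))ψ̃⟩`, `ψ̃` the zero extension, with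
p15's `γ₀ = gamma0 P a m²` — one constant for all `k`, all regions, all volumes (`m² > 0`, `a > 0`, `L > 1`).  Route: §1's
support-respecting block Poincaré + (II.3.29)₀ `ineq329_zero_deltaKA` (whose mass term is dropped, `massK ≥ 0`).
[cite: Balaban1982Higgs1, Prop. 2.3 (2.33) p.611] -/
theorem ineq233_lower_zeroField_region (ha : 0 < a) (hL : 1 < P.L) (hmsq : 0 < msq) (hK : K ≤ P.K) (j : Fin K)
    (hjK : j.val + 1 < P.K) (hs : P.mesh (j.val + 1) ≤ 1)
    (hU : ∀ y y' : HiggsLattice.Site P (j.val + 1), HiggsLattice.blockOf y = HiggsLattice.blockOf y' → (y ∈ R.block j ↔ y' ∈ R.block j))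
    (ψ : LSite R j → V N) :
    min a (8 * gamma0 P a msq) / (P.L : ℝ) ^ 2 * ((P.mesh (j.val + 1))⁻¹ ^ 2) * siteInner (extL R j ψ) (extL R j ψ)
      ≤ siteInner (extL R j ψ)
          (precOpA C (pieceF R j) (0 : HiggsLattice.VecField P 0) msq a (j.val + 1) (extL R j ψ)) := by
  have hL1 : (1 : ℝ) ≤ (P.L : ℝ) := by exact_mod_cast P.hL
  have hm : 0 < P.mesh (j.val + 1) := P.mesh_pos _
  have hsupp : ∀ y, y ∉ R.block j → extL R j ψ y = 0 := fun y hy => extL_apply_of_not R j ψ hy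
  have hP := siteInner_self_le_blockProjA_add_inside C hjK (R.block j) hU (extL R j ψ) hsupp
  rw [sum_inside_eq_bondK] at hP
  have hγ := gamma0_pos (P := P) ha hL hmsq.le
  have hΔ := ineq329_zero_deltaKA R C ha hL hmsq hK j hs ψ
  have hmass := massK_nonneg R hmsq.le j ψ
  have hΔ' : gamma0 P a msq * bondK R j ψ
      ≤ siteInner (extL R j ψ) (deltaKA C (pieceF R j) (0 : HiggsLattice.VecField P 0) msq a (j.val + 1) (extL R j ψ)) := by
    have h1 : gamma0 P a msq * bondK R j ψ ≤ gamma0 P a msq * (bondK R j ψ + massK R msq j ψ) :=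
      mul_le_mul_of_nonneg_left (le_add_of_nonneg_right hmass) hγ.le
    exact h1.trans hΔ
  have hprec : siteInner (extL R j ψ)
        (precOpA C (pieceF R j) (0 : HiggsLattice.VecField P 0) msq a (j.val + 1) (extL R j ψ))
      = a * ((P.mesh (j.val + 1 + 1))⁻¹ ^ 2)
          * siteInner (extL R j ψ) (blockProjA C (0 : HiggsLattice.VecField P 0) (j.val + 1) (extL R j ψ))
        + siteInner (extL R j ψ)
          (deltaKA C (pieceF R j) (0 : HiggsLattice.VecField P 0) msq a (j.val + 1) (extL R j ψ)) := by
    rw [precOpA, LinearMap.add_apply, LinearMap.smul_apply, siteInner_add_right, siteInner_smul_right]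
  rw [hprec, mesh_succ (j.val + 1)]
  exact lower_arith hL1 hm ha.le hγ.le (siteInner_blockProjA_nonneg C 0 (j.val + 1) _) (bondK_nonneg R j ψ) hP hΔ'

/-- **The printed hypothesis verbatim** — *"Ω = B^k(Ω^{(k)}) and … Ω^{(k)} ⊂ T₁^{(k)} … a sum of big blocks"* (Prop. 2.1 p. 610,
the regions of Prop. 2.3): (2.33)ₗ at zero field for `Λ_k` a union of BIG blocks (`HiggsRescaling.IsUnionOfLargeBlocks`).
[cite: Balaban1982Higgs1, Prop. 2.3 (2.33) p.611; Prop. 2.1 p.610] -/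
theorem ineq233_lower_zeroField_region_largeBlocks (ha : 0 < a) (hL : 1 < P.L) (hmsq : 0 < msq) (hK : K ≤ P.K) (j : Fin K)
    (hjK : j.val + 1 < P.K) (hs : P.mesh (j.val + 1) ≤ 1) (hU : IsUnionOfLargeBlocks (R.block j))
    (ψ : LSite R j → V N) :
    min a (8 * gamma0 P a msq) / (P.L : ℝ) ^ 2 * ((P.mesh (j.val + 1))⁻¹ ^ 2) * siteInner (extL R j ψ) (extL R j ψ)
      ≤ siteInner (extL R j ψ)
          (precOpA C (pieceF R j) (0 : HiggsLattice.VecField P 0) msq a (j.val + 1) (extL R j ψ)) :=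
  ineq233_lower_zeroField_region R C ha hL hmsq hK j hjK hs
    (fun y y' h => blockOf_congr_of_isUnionOfLargeBlocks hU y y' h) ψ

/-- The scale-free consequence (`L^kε ≤ 1`, so `(L^kε)^{−2} ≥ 1`): `(min{a, 8γ₀}/L²)‖ψ̃‖² ≤ ⟨ψ̃, (a(L^{k+1}ε)^{−2}P(0) + Δ^{(k)}(Ω,0))ψ̃⟩`.
[cite: Balaban1982Higgs1, Prop. 2.3 (2.33) p.611] -/
theorem ineq233_lower_zeroField_region_uniform (ha : 0 < a) (hL : 1 < P.L) (hmsq : 0 < msq) (hK : K ≤ P.K) (j : Fin K)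
    (hjK : j.val + 1 < P.K) (hs : P.mesh (j.val + 1) ≤ 1)
    (hU : ∀ y y' : HiggsLattice.Site P (j.val + 1), HiggsLattice.blockOf y = HiggsLattice.blockOf y' → (y ∈ R.block j ↔ y' ∈ R.block j))
    (ψ : LSite R j → V N) :
    min a (8 * gamma0 P a msq) / (P.L : ℝ) ^ 2 * siteInner (extL R j ψ) (extL R j ψ)
      ≤ siteInner (extL R j ψ)
          (precOpA C (pieceF R j) (0 : HiggsLattice.VecField P 0) msq a (j.val + 1) (extL R j ψ)) := by
  have h := ineq233_lower_zeroField_region R C ha hL hmsq hK j hjK hs hU ψ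
  have hm : 0 < P.mesh (j.val + 1) := P.mesh_pos _
  have hinv : 1 ≤ (P.mesh (j.val + 1))⁻¹ ^ 2 := by
    have h1 : 1 ≤ (P.mesh (j.val + 1))⁻¹ := (one_le_inv₀ hm).mpr hs
    nlinarith
  have hc : 0 ≤ min a (8 * gamma0 P a msq) / (P.L : ℝ) ^ 2 :=
    (B1Ineq233LowerZeroFieldTorus.lowConst_pos ha hL hmsq.le).le
  have hnn : 0 ≤ siteInner (extL R j ψ) (extL R j ψ) := siteInner_self_nonneg _
  calc min a (8 * gamma0 P a msq) / (P.L : ℝ) ^ 2 * siteInner (extL R j ψ) (extL R j ψ)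
      = min a (8 * gamma0 P a msq) / (P.L : ℝ) ^ 2 * 1 * siteInner (extL R j ψ) (extL R j ψ) := by rw [mul_one]
    _ ≤ min a (8 * gamma0 P a msq) / (P.L : ℝ) ^ 2 * ((P.mesh (j.val + 1))⁻¹ ^ 2)
          * siteInner (extL R j ψ) (extL R j ψ) :=
        mul_le_mul_of_nonneg_right (mul_le_mul_of_nonneg_left hinv hc) hnn
    _ ≤ _ := h

/-- **BOTH HALVES OF (2.33) AT ZERO FIELD FOR THE PRINTED REGIONS** (`1 ≤ k = j + 1 < K`, `L^kε ≤ 1`): for every `ψ : Λ_k → ℝ^N`,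
`(min{a, 8γ₀}/L²)(L^kε)^{−2}‖ψ̃‖² ≤ ⟨ψ̃, (a(L^{k+1}ε)^{−2}P(0) + Δ^{(k),L^kε}(B^k(Λ_k),0))ψ̃⟩ ≤ (aL^{−2} + a)(L^kε)^{−2}‖ψ̃‖²` — the upper
half is r14 g6's `B1Ineq233Upper.siteInner_precOpA_succ_le_uniform` (every `A`, every `Ω`, every field), the lower half §2.
[cite: Balaban1982Higgs1, Prop. 2.3 (2.33) p.611] -/
theorem ineq233_zeroField_region_twoSided (ha : 0 < a) (hL : 1 < P.L) (hmsq : 0 < msq) (hK : K ≤ P.K) (j : Fin K)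
    (hjK : j.val + 1 < P.K) (hs : P.mesh (j.val + 1) ≤ 1)
    (hU : ∀ y y' : HiggsLattice.Site P (j.val + 1), HiggsLattice.blockOf y = HiggsLattice.blockOf y' →
      (y ∈ R.block j ↔ y' ∈ R.block j))
    (ψ : LSite R j → V N) :
    min a (8 * gamma0 P a msq) / (P.L : ℝ) ^ 2 * ((P.mesh (j.val + 1))⁻¹ ^ 2) * siteInner (extL R j ψ) (extL R j ψ)
        ≤ siteInner (extL R j ψ)
            (precOpA C (pieceF R j) (0 : HiggsLattice.VecField P 0) msq a (j.val + 1) (extL R j ψ))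
      ∧ siteInner (extL R j ψ)
            (precOpA C (pieceF R j) (0 : HiggsLattice.VecField P 0) msq a (j.val + 1) (extL R j ψ))
          ≤ (a * ((P.L : ℝ) ^ 2)⁻¹ + a) * ((P.mesh (j.val + 1))⁻¹ ^ 2) * siteInner (extL R j ψ) (extL R j ψ) := by
  have hL' : (1 : ℝ) < (P.L : ℝ) := by exact_mod_cast hL
  exact ⟨ineq233_lower_zeroField_region R C ha hL hmsq hK j hjK hs hU ψ,
    B1Ineq233Upper.siteInner_precOpA_succ_le_uniform C (pieceF R j) (0 : HiggsLattice.VecField P 0) hmsq ha hL' hjK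
      (extL R j ψ)⟩

end Region

/-! ## §3 The level `k = 0`: `Ω ⊂ T_ε` a union of blocks, every `ε` -/

section LevelZero

variable (C : ChargeData N) (Ω : Finset (HiggsLattice.Site P 0)) {a msq : ℝ}

/-- (2.17) at `A = 0` for a region `Ω`: `⟨ψ, Δ^{(0),ε}(Ω, 0)ψ⟩ = Σ_{b⊂Ω}ε^d|(∂ψ)(b)|² + m²‖ψ‖²` for EVERY field `ψ` on `T_ε`
(the Neumann form keeps the bonds inside `Ω`; the mass term acts on all of `T_ε`, the typer's convention for fields extended by
zero). [cite: Balaban1982Higgs1, (2.17) p.610] -/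
theorem siteInner_deltaKA_zero_region (msq a : ℝ) (ψ : ScalarField P 0 N) :
    siteInner ψ (deltaKA C Ω (0 : HiggsLattice.VecField P 0) msq a 0 ψ)
      = (∑ b : HiggsLattice.PBond P 0, (if Inside Ω b then P.mesh 0 ^ P.d * ‖sderiv ψ b‖ ^ 2 else 0))
        + msq * siteInner ψ ψ := by
  have h0 : covDeriv C (0 : HiggsLattice.VecField P 0) ψ = sderiv ψ := funext (covDeriv_zero C ψ)
  simp only [deltaKA_zero, delta0, LinearMap.add_apply, LinearMap.smul_apply, LinearMap.id_apply,
    siteInner_add_right, siteInner_smul_right]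
  rw [siteInner_covLaplacianN C Ω (0 : HiggsLattice.VecField P 0) ψ ψ, h0]
  congr 1
  refine Finset.sum_congr rfl fun b _ => ?_
  split_ifs
  · rw [real_inner_self_eq_norm_sq]
  · rfl

/-- **(2.33), LOWER HALF, AT ZERO FIELD, LEVEL `0`, FOR A UNION OF BLOCKS `Ω ⊂ T_ε`** (every `ε`, `a, m² ≥ 0`, `0 < K`): for every
`ψ` vanishing off `Ω`, `(min{a, 8}/L²)·ε^{−2}·‖ψ‖² ≤ ⟨ψ, (a(Lε)^{−2}P(0) + Δ^{(0),ε}(Ω, 0))ψ⟩` (`γ₀ = 1` for the bond form of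
`−Δ^{ε,N}_{0,Ω}`, the mass term dropped). [cite: Balaban1982Higgs1, Prop. 2.3 (2.33) p.611; (2.17) p.610] -/
theorem ineq233_lower_zeroField_region_levelZero (ha : 0 ≤ a) (hmsq : 0 ≤ msq) (hK : 0 < P.K)
    (hU : ∀ x x' : HiggsLattice.Site P 0, HiggsLattice.blockOf x = HiggsLattice.blockOf x' → (x ∈ Ω ↔ x' ∈ Ω))
    (ψ : ScalarField P 0 N) (hψ : ∀ x, x ∉ Ω → ψ x = 0) :
    min a 8 / (P.L : ℝ) ^ 2 * ((P.mesh 0)⁻¹ ^ 2) * siteInner ψ ψ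
      ≤ siteInner ψ (precOpA C Ω (0 : HiggsLattice.VecField P 0) msq a 0 ψ) := by
  have hL1 : (1 : ℝ) ≤ (P.L : ℝ) := by exact_mod_cast P.hL
  have hm : 0 < P.mesh 0 := P.mesh_pos _
  have hP := siteInner_self_le_blockProjA_add_inside C hK Ω hU ψ hψ
  set S := ∑ b : HiggsLattice.PBond P 0, (if Inside Ω b then P.mesh 0 ^ P.d * ‖sderiv ψ b‖ ^ 2 else 0) with hSdef
  have hS0 : 0 ≤ S := Finset.sum_nonneg fun b _ => by
    split_ifs
    · exact mul_nonneg (pow_nonneg hm.le _) (sq_nonneg _)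
    · exact le_rfl
  have hΔ' : 1 * S ≤ siteInner ψ (deltaKA C Ω (0 : HiggsLattice.VecField P 0) msq a 0 ψ) := by
    rw [siteInner_deltaKA_zero_region, one_mul]
    exact le_add_of_nonneg_right (mul_nonneg hmsq (siteInner_self_nonneg ψ))
  have hprec : siteInner ψ (precOpA C Ω (0 : HiggsLattice.VecField P 0) msq a 0 ψ)
      = a * ((P.mesh (0 + 1))⁻¹ ^ 2) * siteInner ψ (blockProjA C (0 : HiggsLattice.VecField P 0) 0 ψ)
        + siteInner ψ (deltaKA C Ω (0 : HiggsLattice.VecField P 0) msq a 0 ψ) := by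
    rw [precOpA, LinearMap.add_apply, LinearMap.smul_apply, siteInner_add_right, siteInner_smul_right]
  rw [hprec, mesh_succ]
  have h := lower_arith hL1 hm ha zero_le_one (siteInner_blockProjA_nonneg C 0 0 ψ) hS0 hP hΔ'
  rw [mul_one] at h
  exact h

/-- The same for `Ω = B(Λ′)` (`HiggsLattice.blockSet`, (1.18)). [cite: Balaban1982Higgs1, Prop. 2.3 (2.33) p.611; (1.18) p.607] -/
theorem ineq233_lower_zeroField_region_levelZero_blockSet (ha : 0 ≤ a) (hmsq : 0 ≤ msq) (hK : 0 < P.K)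
    (Λ' : Finset (HiggsLattice.Site P (0 + 1))) (ψ : ScalarField P 0 N) (hψ : ∀ x, x ∉ HiggsLattice.blockSet Λ' → ψ x = 0) :
    min a 8 / (P.L : ℝ) ^ 2 * ((P.mesh 0)⁻¹ ^ 2) * siteInner ψ ψ
      ≤ siteInner ψ (precOpA C (HiggsLattice.blockSet Λ') (0 : HiggsLattice.VecField P 0) msq a 0 ψ) :=
  ineq233_lower_zeroField_region_levelZero C (HiggsLattice.blockSet Λ') ha hmsq hK (blockOf_congr_blockSet Λ') ψ hψ

/-- The same for `Ω ⊂ T_ε` a union of BIG blocks (the printed hypothesis of Prop. 2.1 at `k = 0`).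
[cite: Balaban1982Higgs1, Prop. 2.3 (2.33) p.611; Prop. 2.1 p.610] -/
theorem ineq233_lower_zeroField_region_levelZero_largeBlocks (ha : 0 ≤ a) (hmsq : 0 ≤ msq) (hK : 0 < P.K)
    (hU : IsUnionOfLargeBlocks Ω) (ψ : ScalarField P 0 N) (hψ : ∀ x, x ∉ Ω → ψ x = 0) :
    min a 8 / (P.L : ℝ) ^ 2 * ((P.mesh 0)⁻¹ ^ 2) * siteInner ψ ψ
      ≤ siteInner ψ (precOpA C Ω (0 : HiggsLattice.VecField P 0) msq a 0 ψ) :=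
  ineq233_lower_zeroField_region_levelZero C Ω ha hmsq hK (fun x x' h => blockOf_congr_of_isUnionOfLargeBlocks hU x x' h) ψ hψ

end LevelZero

end Literature.MathematicalPhysics.QuantumFieldTheory.Balaban1983to89.B1Ineq233LowerZeroFieldRegion
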